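import Summits.QuantumFields.YangMills.Theorems.UnitScaleTiltProp7LatticeBoxFriedrichsCurved
import Summits.QuantumFields.YangMills.Theorems.UnitScaleTiltProp7EngOfTrueAvgBudget
import Summits.QuantumFields.YangMills.Theorems.PoincareLipschitzCovariantBridge
import HarnessLib

/-!
# Route `UnitScaleTilt`, crux K1 «MinimiserStabilityRegPr» (stmt-QuantumFields-19200), LANE II «DIVERGENCE RECOVERY AT CURVED `W`» (★★OWNER RULING №23),
# brick (T-box): THE INJECTIVE BOX CHART `ℤᵈ ⊃ Q_R(z) ↪ Site P j` — reindexing of site∕bond sums, naturality of the covariant stencils, the member's currencies as box functionals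

Cell `ym3-torus`, width seat `ym3-torus-px12` (gen 7).  THEOREMS ONLY (0 `def`, 0 `sorry`); `--supports stmt-QuantumFields-19200 --as helper`, count-neutral.
YM₃ on T³ is a ladder rung (R3), not d = 4, not the Clay problem; nothing here claims a stub, the crux or the gap.

THE POINT.  Lane II's bricks (B1′)∕(B1″)∕(B8)∕(B9) are typed on `ℤᵈ` boxes `box z R` (lit `B4Eq19LatticeOperators`) with connections `V : Zd d → Fin d → 𝔸ˣ` and one-forms
`g : Zd d → Fin d → 𝔸`; the member's currencies (`‖toL2 X‖²`, `‖D*_W(toL2 X)‖²`, `CURL_HS`, `‖toL2S φ‖²`, `‖D_W(toL2S φ)‖²`) are site∕bond sums over `Site (F.P K) 0` of the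
generic stencils of lit `B9Eq39Adjoint` at the torus steps `torusT`.  The chart is `y ↦ transl c y` (lit `B10Eq27TorusAxialLog.transl`), any centre `c`.
* §1 `torusT_transl`, `torusT_symm_transl` (over the 19936 COV-BRIDGE's pointwise ✓`transl_add_unitVec`∕`transl_sub_unitVec`), `transl_eq_transl_iff`,
  ★`transl_injOn_box`: the chart is INJECTIVE on every box `Q_R(z)` with `2R + 1 ≤ N` — the one hypothesis every ENERGY identity needs.
* §2 ★★`sum_site_eq_sum_box`∕`sum_bond_eq_sum_box`: a site (bond) sum of a function vanishing off the chart image of `Q_R(z)` IS the box sum;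
  §2b ★`exists_site_pushforward`∕`exists_bond_pushforward`: box data extend by zero to the torus, agreeing along the chart (the letters in which (B8)'s
  `φ_i, κ_i, r_i` become member fields).
* §3 `covD_transl`, `covDstar_transl`, ★`curl_transl`, ★`divB_transl`: the stencils at a chart point are px4's `ℤᵈ` summands VERBATIM (token order of
  ✓`sum_sq_le_box_friedrichs_plaq`) for the pull-backs `g y κ := A κ (transl c y)`, `V y κ := U κ (transl c y)` (`conjR ≡ R` by `rfl`).
* §4 ★`curl_eq_zero_off_box`, ★`divB_eq_zero_off_box`: a one-form living over `Q_{R−1}(z)` has its radius-1 stencils living over `Q_R(z)`.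
* §5 (member `F : T3Family`) ★★`norm_toL2_sq_eq_sum_box`, ★★`norm_sq_DstarL2_toL2_eq_sum_box`, ★★`curlHS_eq_sum_box`, §5b ★★`norm_sq_toL2S_eq_sum_box`,
  ★★`norm_sq_DL2_toL2S_eq_sum_box`, each with an operator-norm reading both ways (`…_le_ge_box`, factor `2`: ✓`MatrixNorms.opNorm_sq_le_sum_norm_sq`,
  ✓`sum_norm_sq_le_two_mul_opNorm_sq`).
HONEST SCOPE.  Finite reindexing and unfolding; no analysis, no YM content.

References: T. Bałaban, CMP 99 (1985) 389–434 [Balaban1985BackgroundPropagators] ((3.1)–(3.11) pp.390–392, (3.100) p.413); CMP 99 (1985) 75–102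
[Balaban1985RegularSpaces] ((1.1)–(1.2) p.76); CMP 98 (1985) 17–51 [Balaban1985Averaging] ((18)–(20) p.21); M. Giaquinta, *Multiple integrals in the calculus of
variations and nonlinear elliptic systems* (1983) [Giaquinta1984] (Ch. III §1).
-/

set_option autoImplicit false

noncomputable section

open scoped BigOperators Matrix.Norms.L2Operator
open Finset

namespace Summit.QuantumFields.YangMills.Theorems.Prop7BoxChartTransport

open Literature.MathematicalPhysics.QuantumFieldTheory.Balaban1983to89
open Literature.MathematicalPhysics.QuantumFieldTheory.Balaban1983to89.B4Eq19LatticeOperators (Zd box mem_box unitVec unitVec_apply_self unitVec_apply_ne box_mono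
  add_unitVec_mem_box sub_unitVec_mem_box)
open B10Eq27TorusAxialLog (transl transl_apply)
open B9TorusCalculus (torusT torusT_apply torusT_symm_apply)
open B9Eq39Adjoint (covD covDstar curl divB)
open B7Eq78Linearization (conjR)
open Summit.QuantumFields.YangMills.Theorems.PoincareLipschitzCovariantBridge (transl_add_unitVec transl_sub_unitVec)

variable {P : Params} {j : ℕ}

/-! ## §1 The chart `y ↦ transl c y`: steps and injectivity on boxes -/

/-- The torus step at a chart point: `torusT μ (transl c y) = transl c (y + e_μ)`. [folklore] [cite: Balaban1985BackgroundPropagators, (3.1) p.390] -/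
theorem torusT_transl (c : Site P j) (y : Zd P.d) (μ : Fin P.d) : torusT P j μ (transl c y) = transl c (y + unitVec μ) := by
  rw [torusT_apply, transl_add_unitVec]

/-- The inverse torus step at a chart point: `(torusT μ)⁻¹ (transl c y) = transl c (y − e_μ)`. [folklore] [cite: Balaban1985BackgroundPropagators, (3.8) p.392] -/
theorem torusT_symm_transl (c : Site P j) (y : Zd P.d) (μ : Fin P.d) : (torusT P j μ).symm (transl c y) = transl c (y - unitVec μ) := by
  rw [torusT_symm_apply, transl_sub_unitVec]

/-- Two integer points have the same chart image iff they are congruent mod `N` coordinatewise. [folklore] -/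
theorem transl_eq_transl_iff (c : Site P j) (y y' : Zd P.d) :
    transl c y = transl c y' ↔ ∀ ν, ((P.sitesPerDir j : ℕ) : ℤ) ∣ y' ν - y ν := by
  refine ⟨fun h ν => ?_, fun h => funext fun ν => ?_⟩
  · have hν := congrFun h ν
    rw [transl_apply, transl_apply, add_right_inj] at hν
    exact (ZMod.intCast_eq_intCast_iff_dvd_sub _ _ _).mp hν
  · rw [transl_apply, transl_apply, add_right_inj]; exact (ZMod.intCast_eq_intCast_iff_dvd_sub _ _ _).mpr (h ν)

/-- ★ **THE CHART IS INJECTIVE ON EVERY BOX OF SIDE `2R + 1 ≤ N`.** [folklore] [cite: Balaban1985BackgroundPropagators, (3.100) p.413] -/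
theorem transl_injOn_box (c : Site P j) {z : Zd P.d} {R : ℤ} (hR : 2 * R + 1 ≤ (P.sitesPerDir j : ℤ)) :
    Set.InjOn (transl c) (↑(box z R) : Set (Zd P.d)) := by
  intro y hy y' hy' h
  rw [Finset.mem_coe, mem_box] at hy hy'
  rw [transl_eq_transl_iff] at h
  funext ν
  have h1 := abs_le.mp (hy ν); have h2 := abs_le.mp (hy' ν)
  have habs : |y' ν - y ν| < (P.sitesPerDir j : ℤ) := by rw [abs_lt]; constructor <;> linarith [h1.1, h1.2, h2.1, h2.2]
  linarith [Int.eq_zero_of_abs_lt_dvd (h ν) habs]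

/-! ## §2 Site and bond sums of chart-supported functions are box sums -/

/-- ★★ **A SITE SUM OF A FUNCTION VANISHING OFF THE CHART IMAGE OF `Q_R(z)` IS THE BOX SUM** (`2R + 1 ≤ N`). [folklore]
[cite: Balaban1985BackgroundPropagators, (3.100) p.413] -/
theorem sum_site_eq_sum_box {α : Type*} [AddCommMonoid α] (c : Site P j) {z : Zd P.d} {R : ℤ} (hR : 2 * R + 1 ≤ (P.sitesPerDir j : ℤ))
    (Φ : Site P j → α) (hΦ : ∀ x, (∀ y ∈ box z R, transl c y ≠ x) → Φ x = 0) :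
    ∑ x, Φ x = ∑ y ∈ box z R, Φ (transl c y) := by
  classical
  rw [← Finset.sum_image (transl_injOn_box c hR)]
  symm
  refine Finset.sum_subset (Finset.subset_univ _) fun x _ hx => hΦ x fun y hy hxy => hx ?_
  exact Finset.mem_image.mpr ⟨y, hy, hxy⟩

/-- **THE BOND VERSION**: a bond sum of a function vanishing off the bonds based in the chart image of `Q_R(z)` is the box sum over base points and directions. [folklore]
[cite: Balaban1985BackgroundPropagators, (3.100) p.413] -/
theorem sum_bond_eq_sum_box {α : Type*} [AddCommMonoid α] (c : Site P j) {z : Zd P.d} {R : ℤ} (hR : 2 * R + 1 ≤ (P.sitesPerDir j : ℤ))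
    (Ψ : PBond P j → α) (hΨ : ∀ b : PBond P j, (∀ y ∈ box z R, transl c y ≠ b.src) → Ψ b = 0) :
    ∑ b, Ψ b = ∑ y ∈ box z R, ∑ μ, Ψ ⟨transl c y, μ⟩ := by
  classical
  have hb : ∑ b : PBond P j, Ψ b = ∑ x : Site P j, ∑ μ : Fin P.d, Ψ ⟨x, μ⟩ := by
    rw [← Finset.sum_product' (f := fun x μ => Ψ ⟨x, μ⟩), Finset.univ_product_univ]
    exact Fintype.sum_equiv ⟨fun b => (b.src, b.dir), fun p => ⟨p.1, p.2⟩, fun _ => rfl, fun _ => rfl⟩ _ _ fun _ => rfl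
  rw [hb]
  exact sum_site_eq_sum_box c hR (fun x => ∑ μ : Fin P.d, Ψ ⟨x, μ⟩) fun x hx => Finset.sum_eq_zero fun μ _ => hΨ ⟨x, μ⟩ hx


/-! ## §2b Push-forward: box data extend by zero to the torus, well-defined by injectivity -/

/-- ★ **PUSH-FORWARD OF SITE DATA**: for `2R + 1 ≤ N`, every `φ : ℤᵈ → α` has an extension-by-zero `Φ` on the torus agreeing with `φ` along the chart of `Q_R(z)` and vanishing
off its image (well-defined by `transl_injOn_box`). [folklore] [cite: Balaban1985BackgroundPropagators, (3.100) p.413] -/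
theorem exists_site_pushforward {α : Type*} [Zero α] (c : Site P j) {z : Zd P.d} {R : ℤ} (hR : 2 * R + 1 ≤ (P.sitesPerDir j : ℤ)) (φ : Zd P.d → α) :
    ∃ Φ : Site P j → α, (∀ y ∈ box z R, Φ (transl c y) = φ y) ∧ ∀ x, (∀ y ∈ box z R, transl c y ≠ x) → Φ x = 0 := by
  classical
  refine ⟨fun x => if h : ∃ y ∈ box z R, transl c y = x then φ h.choose else 0, fun y hy => ?_, fun x hx => ?_⟩
  · have h : ∃ y' ∈ box z R, transl c y' = transl c y := ⟨y, hy, rfl⟩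
    show (if h : ∃ y' ∈ box z R, transl c y' = transl c y then φ h.choose else 0) = φ y
    rw [dif_pos h]
    congr 1
    exact transl_injOn_box c hR (Finset.mem_coe.mpr h.choose_spec.1) (Finset.mem_coe.mpr hy) h.choose_spec.2
  · show (if h : ∃ y ∈ box z R, transl c y = x then φ h.choose else 0) = 0
    rw [dif_neg]
    rintro ⟨y, hy, hxy⟩
    exact hx y hy hxy

/-- ★ **PUSH-FORWARD OF BOND DATA**: for `2R + 1 ≤ N`, every `g : ℤᵈ → Fin d → α` has an extension-by-zero `X` on the torus bonds with `X ⟨transl c y, μ⟩ = g y μ` on `Q_R(z)`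
and `X b = 0` off the bonds based in the chart image. [folklore] [cite: Balaban1985BackgroundPropagators, (3.100) p.413] -/
theorem exists_bond_pushforward {α : Type*} [Zero α] (c : Site P j) {z : Zd P.d} {R : ℤ} (hR : 2 * R + 1 ≤ (P.sitesPerDir j : ℤ)) (g : Zd P.d → Fin P.d → α) :
    ∃ X : PBond P j → α, (∀ y ∈ box z R, ∀ μ, X ⟨transl c y, μ⟩ = g y μ) ∧ ∀ b : PBond P j, (∀ y ∈ box z R, transl c y ≠ b.src) → X b = 0 := by
  obtain ⟨Φ, hΦ, hΦ0⟩ := exists_site_pushforward c hR g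
  refine ⟨fun b => Φ b.src b.dir, fun y hy μ => ?_, fun b hb => ?_⟩
  · show Φ (transl c y) μ = g y μ
    rw [hΦ y hy]
  · show Φ b.src b.dir = 0
    rw [hΦ0 b.src hb]; rfl

/-! ## §3 The covariant stencils at a chart point, in the `ℤᵈ` letters of (B1′)∕(B1″)∕(B8)∕(B9) -/

section Stencils

variable {N : ℕ}

/-- `covD μ f (transl c y) = conjR (U μ (transl c y)) (f (transl c (y + e_μ))) − f (transl c y)`. [cite: Balaban1985BackgroundPropagators, (3.1) p.390] -/
theorem covD_transl (U : Fin P.d → Site P j → (Matrix (Fin N) (Fin N) ℂ)ˣ) (μ : Fin P.d) (f : Site P j → Matrix (Fin N) (Fin N) ℂ) (c : Site P j) (y : Zd P.d) :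
    covD (torusT P j) U μ f (transl c y) = conjR (U μ (transl c y)) (f (transl c (y + unitVec μ))) - f (transl c y) := by
  rw [covD, torusT_transl]; rfl

/-- `covD* μ G (transl c y) = (conjR (U μ (transl c (y − e_μ))))⁻¹-conjugate … − G (transl c y)`, i.e.
`conjR (U μ (transl c (y − e_μ)))⁻¹ (G (transl c (y − e_μ))) − G (transl c y)`. [cite: Balaban1985BackgroundPropagators, (3.8) p.392] -/
theorem covDstar_transl (U : Fin P.d → Site P j → (Matrix (Fin N) (Fin N) ℂ)ˣ) (μ : Fin P.d) (G : Site P j → Matrix (Fin N) (Fin N) ℂ) (c : Site P j) (y : Zd P.d) :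
    covDstar (torusT P j) U μ G (transl c y) = conjR (U μ (transl c (y - unitVec μ)))⁻¹ (G (transl c (y - unitVec μ))) - G (transl c y) := by
  rw [covDstar, torusT_symm_transl]; rfl

/-- ★ **THE CURL AT A CHART POINT IS px4's `ℤᵈ` CURL SUMMAND VERBATIM** for `g y κ := A κ (transl c y)`, `V y κ := U κ (transl c y)`:
`curl μ ν (transl c y) = g y μ + conjR (V y μ) (g (y + e_μ) ν) − conjR (V y ν) (g (y + e_ν) μ) − g y ν`. [cite: Balaban1985BackgroundPropagators, (3.10) p.392] -/
theorem curl_transl (U : Fin P.d → Site P j → (Matrix (Fin N) (Fin N) ℂ)ˣ) (A : Fin P.d → Site P j → Matrix (Fin N) (Fin N) ℂ) (μ ν : Fin P.d) (c : Site P j) (y : Zd P.d) :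
    curl (torusT P j) U A μ ν (transl c y)
      = A μ (transl c y) + conjR (U μ (transl c y)) (A ν (transl c (y + unitVec μ)))
          - conjR (U ν (transl c y)) (A μ (transl c (y + unitVec ν))) - A ν (transl c y) := by
  rw [curl, covD_transl, covD_transl]
  abel

/-- ★ **THE DIVERGENCE AT A CHART POINT IS px4's `ℤᵈ` DIVERGENCE VERBATIM**:
`divB (transl c y) = Σ_μ (conjR (V (y − e_μ) μ)⁻¹ (g (y − e_μ) μ) − g y μ)`. [cite: Balaban1985BackgroundPropagators, (3.8) p.392] -/
theorem divB_transl (U : Fin P.d → Site P j → (Matrix (Fin N) (Fin N) ℂ)ˣ) (A : Fin P.d → Site P j → Matrix (Fin N) (Fin N) ℂ) (c : Site P j) (y : Zd P.d) :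
    divB (torusT P j) U A (transl c y)
      = ∑ μ, (conjR (U μ (transl c (y - unitVec μ)))⁻¹ (A μ (transl c (y - unitVec μ))) - A μ (transl c y)) := by
  rw [divB]
  exact Finset.sum_congr rfl fun μ _ => covDstar_transl U μ (A μ) c y

end Stencils

/-! ## §4 Support propagation: radius-1 stencils of a field living over `Q_{R−1}(z)` live over `Q_R(z)` -/

/-- If `x` is not a chart point of `Q_R(z)` then `x + e_μ` is not a chart point of `Q_{R−1}(z)`. [folklore] [cite: Giaquinta1984, Ch. III §1 p.64] -/
theorem shift_ne_transl_of_ne (c : Site P j) {z : Zd P.d} {R : ℤ} {x : Site P j} (hx : ∀ y ∈ box z R, transl c y ≠ x) (μ : Fin P.d) :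
    ∀ y ∈ box z (R - 1), transl c y ≠ x.shift μ := by
  intro y hy h
  have hmem : y - unitVec μ ∈ box z R := by simpa using sub_unitVec_mem_box hy μ
  refine hx (y - unitVec μ) hmem ?_
  rw [transl_sub_unitVec, h]
  funext κ; rw [Site.unshift, Site.shift]; by_cases hκ : κ = μ
  · subst hκ; rw [Function.update_self, Function.update_self]; ring
  · rw [Function.update_of_ne hκ, Function.update_of_ne hκ]

/-- If `x` is not a chart point of `Q_R(z)` then `x − e_μ` is not a chart point of `Q_{R−1}(z)`. [folklore] [cite: Giaquinta1984, Ch. III §1 p.64] -/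
theorem unshift_ne_transl_of_ne (c : Site P j) {z : Zd P.d} {R : ℤ} {x : Site P j} (hx : ∀ y ∈ box z R, transl c y ≠ x) (μ : Fin P.d) :
    ∀ y ∈ box z (R - 1), transl c y ≠ x.unshift μ := by
  intro y hy h
  have hmem : y + unitVec μ ∈ box z R := by simpa using add_unitVec_mem_box hy μ
  refine hx (y + unitVec μ) hmem ?_
  rw [transl_add_unitVec, h]
  funext κ; rw [Site.unshift, Site.shift]; by_cases hκ : κ = μ
  · subst hκ; rw [Function.update_self, Function.update_self]; ring
  · rw [Function.update_of_ne hκ, Function.update_of_ne hκ]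

/-- If `x` is not a chart point of `Q_R(z)` it is not one of `Q_{R−1}(z)`. [folklore] [cite: Giaquinta1984, Ch. III §1 p.64] -/
theorem ne_transl_of_ne (c : Site P j) {z : Zd P.d} {R : ℤ} {x : Site P j} (hx : ∀ y ∈ box z R, transl c y ≠ x) :
    ∀ y ∈ box z (R - 1), transl c y ≠ x := fun y hy => hx y (box_mono z (by linarith) hy)

section StencilSupport

variable {𝔸 : Type*} [Ring 𝔸]

/-- ★ **THE CURL OF A ONE-FORM LIVING OVER `Q_{R−1}(z)` LIVES OVER `Q_R(z)`**: if every component `A κ` vanishes off the chart image of `Q_{R−1}(z)`, then `curl μ ν x = 0` at every `x`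
off the chart image of `Q_R(z)`. [cite: Balaban1985BackgroundPropagators, (3.10) p.392; Giaquinta1984, Ch. III §1 p.64] -/
theorem curl_eq_zero_off_box (U : Fin P.d → Site P j → 𝔸ˣ) (A : Fin P.d → Site P j → 𝔸) (c : Site P j) {z : Zd P.d} {R : ℤ}
    (hA : ∀ κ x, (∀ y ∈ box z (R - 1), transl c y ≠ x) → A κ x = 0) (μ ν : Fin P.d) (x : Site P j) (hx : ∀ y ∈ box z R, transl c y ≠ x) :
    curl (torusT P j) U A μ ν x = 0 := by
  rw [curl, covD, covD, torusT_apply, torusT_apply, hA ν _ (shift_ne_transl_of_ne c hx μ), hA μ _ (shift_ne_transl_of_ne c hx ν),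
    hA μ x (ne_transl_of_ne c hx), hA ν x (ne_transl_of_ne c hx)]
  simp

/-- ★ **THE DIVERGENCE OF A ONE-FORM LIVING OVER `Q_{R−1}(z)` LIVES OVER `Q_R(z)`.** [cite: Balaban1985BackgroundPropagators, (3.8) p.392; Giaquinta1984, Ch. III §1 p.64] -/
theorem divB_eq_zero_off_box (U : Fin P.d → Site P j → 𝔸ˣ) (A : Fin P.d → Site P j → 𝔸) (c : Site P j) {z : Zd P.d} {R : ℤ}
    (hA : ∀ κ x, (∀ y ∈ box z (R - 1), transl c y ≠ x) → A κ x = 0) (x : Site P j) (hx : ∀ y ∈ box z R, transl c y ≠ x) :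
    divB (torusT P j) U A x = 0 := by
  rw [divB]
  refine Finset.sum_eq_zero fun μ _ => ?_
  rw [covDstar, torusT_symm_apply, hA μ _ (unshift_ne_transl_of_ne c hx μ), hA μ x (ne_transl_of_ne c hx)]
  simp

end StencilSupport

/-! ## §5 The member's currencies over a chart-supported field are `ℤᵈ` box functionals (Frobenius letters; operator norm within a factor `2`) -/

section Member

open scoped InnerProductSpace
open Literature.MathematicalPhysics.QuantumFieldTheory.Balaban1983to89.T3ContinuumYM3Torus
open B10Eq27TorusAxialLog (unitsField toUField)
open T3SectALandauChart (eta eta_pos covDerivFwdT bgUnits)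
open Summit.QuantumFields.YangMills.Theorems.Prop7SectET3HilbertLetters (W₂ frobEquiv toL2 toL2S DL2 DstarL2)
open Summit.QuantumFields.YangMills.Theorems.Prop7DeltaEtaAlmostPositive (norm_toL2_sq)
open Summit.QuantumFields.YangMills.Theorems.Prop7LaplaceAFlatLetters (norm_sq_toL2S)
open Summit.QuantumFields.YangMills.Theorems.Prop7LandauDict (DL2_toL2S_eq_covDerivFwdT)
open Summit.QuantumFields.YangMills.Theorems.Prop7DivSliceOfMemberDivSq (norm_sq_DstarL2_toL2_eq inv_eta_sq_eq)
open Summit.QuantumFields.YangMills.Theorems.Prop7RieszTauFrobNorm (norm_sq_frobEquiv_symm sum_norm_sq_le_two_mul_opNorm_sq)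

variable (F : T3Family) (n K : ℕ) (c₀ : ℝ) [Fact (0 < c₀)]

/-- ★★ **`‖toL2 X‖²` IS THE BOX SUM** for `X` vanishing off the bonds based in the chart image of `Q_R(z)` (`2R + 1 ≤ N`):
`‖toL2 X‖² = c₀·Σ_{y ∈ Q_R(z)} Σ_μ Σ_j Σ_k ‖(X ⟨transl c y, μ⟩) j k‖²`. [cite: Balaban1985BackgroundPropagators, (3.11) p.392, (3.100) p.413] -/
theorem norm_toL2_sq_eq_sum_box (c : Site (F.P K) 0) {z : Zd (F.P K).d} {R : ℤ} (hR : 2 * R + 1 ≤ ((F.P K).sitesPerDir 0 : ℤ))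
    (X : PBond (F.P K) 0 → Matrix (Fin 2) (Fin 2) ℂ) (hX : ∀ b : PBond (F.P K) 0, (∀ y ∈ box z R, transl c y ≠ b.src) → X b = 0) :
    ‖toL2 F K c₀ X‖ ^ 2 = c₀ * ∑ y ∈ box z R, ∑ μ : Fin (F.P K).d, ∑ j : Fin 2, ∑ k : Fin 2, ‖(X ⟨transl c y, μ⟩) j k‖ ^ 2 := by
  rw [norm_toL2_sq, sum_bond_eq_sum_box c hR (fun b => ‖(frobEquiv.symm (X b) : W₂)‖ ^ 2) fun b hb => by
    rw [hX b hb, map_zero, norm_zero, zero_pow two_ne_zero]]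
  simp only [norm_sq_frobEquiv_symm]

/-- **OPERATOR-NORM READING, BOTH WAYS**: `c₀·Σ_{Q_R}Σ_μ ‖g y μ‖² ≤ ‖toL2 X‖² ≤ 2c₀·Σ_{Q_R}Σ_μ ‖g y μ‖²` for any `g` agreeing with the pull-back of `X` on the box.
[cite: Balaban1985Averaging, (18)-(20) p.21; Balaban1985BackgroundPropagators, (3.11) p.392] -/
theorem norm_toL2_sq_le_ge_box (c : Site (F.P K) 0) {z : Zd (F.P K).d} {R : ℤ} (hR : 2 * R + 1 ≤ ((F.P K).sitesPerDir 0 : ℤ))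
    (X : PBond (F.P K) 0 → Matrix (Fin 2) (Fin 2) ℂ) (hX : ∀ b : PBond (F.P K) 0, (∀ y ∈ box z R, transl c y ≠ b.src) → X b = 0)
    (g : Zd (F.P K).d → Fin (F.P K).d → Matrix (Fin 2) (Fin 2) ℂ) (hg : ∀ y ∈ box z R, ∀ μ, g y μ = X ⟨transl c y, μ⟩) :
    c₀ * ∑ y ∈ box z R, ∑ μ, ‖g y μ‖ ^ 2 ≤ ‖toL2 F K c₀ X‖ ^ 2 ∧ ‖toL2 F K c₀ X‖ ^ 2 ≤ 2 * c₀ * ∑ y ∈ box z R, ∑ μ, ‖g y μ‖ ^ 2 := by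
  have hc₀ : 0 < c₀ := Fact.out
  rw [norm_toL2_sq_eq_sum_box F K c₀ c hR X hX]
  constructor
  · refine mul_le_mul_of_nonneg_left (Finset.sum_le_sum fun y hy => Finset.sum_le_sum fun μ _ => ?_) hc₀.le
    rw [hg y hy μ]
    exact MatrixNorms.opNorm_sq_le_sum_norm_sq _
  · calc c₀ * ∑ y ∈ box z R, ∑ μ : Fin (F.P K).d, ∑ j : Fin 2, ∑ k : Fin 2, ‖(X ⟨transl c y, μ⟩) j k‖ ^ 2
        ≤ c₀ * ∑ y ∈ box z R, ∑ μ : Fin (F.P K).d, 2 * ‖g y μ‖ ^ 2 := by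
          refine mul_le_mul_of_nonneg_left (Finset.sum_le_sum fun y hy => Finset.sum_le_sum fun μ _ => ?_) hc₀.le
          rw [hg y hy μ]
          exact sum_norm_sq_le_two_mul_opNorm_sq _
      _ = 2 * c₀ * ∑ y ∈ box z R, ∑ μ, ‖g y μ‖ ^ 2 := by
          rw [mul_comm 2 c₀, mul_assoc, Finset.mul_sum (s := box z R) (a := (2 : ℝ))]
          refine congrArg (c₀ * ·) (Finset.sum_congr rfl fun y _ => ?_)
          rw [Finset.mul_sum]

/-- ★★ **`‖D*_W (toL2 X)‖²` IS `c₀ℓ²` TIMES THE BOX SUM OF px4's `ℤᵈ` DIVERGENCE** (Frobenius letters) for `X` vanishing off the bonds based in the chart image of `Q_{R−1}(z)`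
(`2R + 1 ≤ N`). [cite: Balaban1985BackgroundPropagators, (3.8) p.392, (3.100) p.413; Balaban1985Variational, (14) p.280] -/
theorem norm_sq_DstarL2_toL2_eq_sum_box (c : Site (F.P K) 0) {z : Zd (F.P K).d} {R : ℤ} (hR : 2 * R + 1 ≤ ((F.P K).sitesPerDir 0 : ℤ))
    (W : GaugeField (F.P K) 0 (Matrix.specialUnitaryGroup (Fin 2) ℂ))
    (X : PBond (F.P K) 0 → Matrix (Fin 2) (Fin 2) ℂ) (hX : ∀ b : PBond (F.P K) 0, (∀ y ∈ box z (R - 1), transl c y ≠ b.src) → X b = 0) :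
    ‖DstarL2 F n K c₀ W (toL2 F K c₀ X)‖ ^ 2
      = c₀ * ((F.L : ℝ) ^ (K - n)) ^ 2 * ∑ y ∈ box z R, ∑ j : Fin 2, ∑ k : Fin 2,
          ‖(∑ μ, (conjR (unitsField (toUField W) ⟨transl c (y - unitVec μ), μ⟩)⁻¹ (X ⟨transl c (y - unitVec μ), μ⟩) - X ⟨transl c y, μ⟩)) j k‖ ^ 2 := by
  rw [norm_sq_DstarL2_toL2_eq]
  congr 1
  have hA : ∀ (κ : Fin (F.P K).d) (x : Site (F.P K) 0), (∀ y ∈ box z (R - 1), transl c y ≠ x) → (fun κ w => X ⟨w, κ⟩) κ x = 0 :=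
    fun κ x hx => hX ⟨x, κ⟩ hx
  rw [sum_site_eq_sum_box c hR _ fun x hx => by
    rw [divB_eq_zero_off_box _ _ c hA x hx]; simp]
  refine Finset.sum_congr rfl fun y _ => ?_
  rw [divB_transl]

/-- **OPERATOR-NORM READING, BOTH WAYS**: with `DIV_box(V,g) := Σ_{y ∈ Q_R(z)} ‖Σ_μ (conjR (V (y − e_μ) μ)⁻¹ (g (y − e_μ) μ) − g y μ)‖²` (the token shape of (B1′)∕(B1″)),
`c₀ℓ²·DIV_box ≤ ‖D*_W (toL2 X)‖² ≤ 2c₀ℓ²·DIV_box` for any `g`, `V` agreeing with the pull-backs of `X`, `W♮` on `Q_{R+1}(z) ⊇` the stencil.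
[cite: Balaban1985BackgroundPropagators, (3.8) p.392; Balaban1985Averaging, (18)-(20) p.21] -/
theorem norm_sq_DstarL2_toL2_le_ge_box (c : Site (F.P K) 0) {z : Zd (F.P K).d} {R : ℤ} (hR : 2 * R + 1 ≤ ((F.P K).sitesPerDir 0 : ℤ))
    (W : GaugeField (F.P K) 0 (Matrix.specialUnitaryGroup (Fin 2) ℂ))
    (X : PBond (F.P K) 0 → Matrix (Fin 2) (Fin 2) ℂ) (hX : ∀ b : PBond (F.P K) 0, (∀ y ∈ box z (R - 1), transl c y ≠ b.src) → X b = 0)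
    (g : Zd (F.P K).d → Fin (F.P K).d → Matrix (Fin 2) (Fin 2) ℂ) (hg : ∀ y μ, g y μ = X ⟨transl c y, μ⟩)
    (V : Zd (F.P K).d → Fin (F.P K).d → (Matrix (Fin 2) (Fin 2) ℂ)ˣ) (hV : ∀ y μ, V y μ = unitsField (toUField W) ⟨transl c y, μ⟩) :
    c₀ * ((F.L : ℝ) ^ (K - n)) ^ 2 * ∑ y ∈ box z R, ‖∑ μ, (conjR (V (y - unitVec μ) μ)⁻¹ (g (y - unitVec μ) μ) - g y μ)‖ ^ 2
        ≤ ‖DstarL2 F n K c₀ W (toL2 F K c₀ X)‖ ^ 2 ∧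
      ‖DstarL2 F n K c₀ W (toL2 F K c₀ X)‖ ^ 2
        ≤ 2 * (c₀ * ((F.L : ℝ) ^ (K - n)) ^ 2) * ∑ y ∈ box z R, ‖∑ μ, (conjR (V (y - unitVec μ) μ)⁻¹ (g (y - unitVec μ) μ) - g y μ)‖ ^ 2 := by
  have hc₀ : 0 < c₀ := Fact.out
  have hpos : 0 ≤ c₀ * ((F.L : ℝ) ^ (K - n)) ^ 2 := by positivity
  rw [norm_sq_DstarL2_toL2_eq_sum_box F n K c₀ c hR W X hX]
  simp only [hg, hV]
  constructor
  · exact mul_le_mul_of_nonneg_left (Finset.sum_le_sum fun y _ => MatrixNorms.opNorm_sq_le_sum_norm_sq _) hpos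
  · rw [mul_assoc (2 : ℝ), mul_left_comm (2 : ℝ), Finset.mul_sum (s := box z R) (a := (2 : ℝ))]
    exact mul_le_mul_of_nonneg_left (Finset.sum_le_sum fun y _ => sum_norm_sq_le_two_mul_opNorm_sq _) hpos

/-- ★★ **THE MEMBER's `CURL_HS(X)` IS THE BOX SUM OF px4's `ℤᵈ` CURL** (Frobenius letters, pairs `μ < ν`) for `X` vanishing off the bonds based in the chart image of
`Q_{R−1}(z)` (`2R + 1 ≤ N`). [cite: Balaban1985BackgroundPropagators, (3.10) p.392, (3.100) p.413] -/
theorem curlHS_eq_sum_box (c : Site (F.P K) 0) {z : Zd (F.P K).d} {R : ℤ} (hR : 2 * R + 1 ≤ ((F.P K).sitesPerDir 0 : ℤ))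
    (W : GaugeField (F.P K) 0 (Matrix.specialUnitaryGroup (Fin 2) ℂ))
    (X : PBond (F.P K) 0 → Matrix (Fin 2) (Fin 2) ℂ) (hX : ∀ b : PBond (F.P K) 0, (∀ y ∈ box z (R - 1), transl c y ≠ b.src) → X b = 0) :
    (∑ x : Site (F.P K) 0, ∑ μ : Fin (F.P K).d, ∑ ν : Fin (F.P K).d,
        (if μ < ν then ∑ j : Fin 2, ∑ k : Fin 2,
          ‖(curl (torusT (F.P K) 0) (fun κ w => unitsField (toUField W) ⟨w, κ⟩) (fun κ w => X ⟨w, κ⟩) μ ν x) j k‖ ^ 2 else 0))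
      = ∑ y ∈ box z R, ∑ μ : Fin (F.P K).d, ∑ ν : Fin (F.P K).d,
          (if μ < ν then ∑ j : Fin 2, ∑ k : Fin 2,
            ‖(X ⟨transl c y, μ⟩ + conjR (unitsField (toUField W) ⟨transl c y, μ⟩) (X ⟨transl c (y + unitVec μ), ν⟩)
                - conjR (unitsField (toUField W) ⟨transl c y, ν⟩) (X ⟨transl c (y + unitVec ν), μ⟩) - X ⟨transl c y, ν⟩) j k‖ ^ 2 else 0) := by
  have hA : ∀ (κ : Fin (F.P K).d) (x : Site (F.P K) 0), (∀ y ∈ box z (R - 1), transl c y ≠ x) → (fun κ w => X ⟨w, κ⟩) κ x = 0 :=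
    fun κ x hx => hX ⟨x, κ⟩ hx
  rw [sum_site_eq_sum_box c hR _ fun x hx => by
    refine Finset.sum_eq_zero fun μ _ => Finset.sum_eq_zero fun ν _ => ?_
    rw [curl_eq_zero_off_box _ _ c hA μ ν x hx]; simp]
  refine Finset.sum_congr rfl fun y _ => Finset.sum_congr rfl fun μ _ => Finset.sum_congr rfl fun ν _ => ?_
  rw [curl_transl]

/-! ## §5b The site twin: `‖toL2S φ‖²` and the gradient energy `‖D_W (toL2S φ)‖²` of a chart-supported site field are box functionals ((B8)(i)(iv) readings) -/

/-- ★★ **`‖toL2S φ‖²` IS THE BOX SUM** for a site field vanishing off the chart image of `Q_R(z)` (`2R + 1 ≤ N`). [cite: Balaban1985BackgroundPropagators, (3.11) p.392, (3.100) p.413] -/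
theorem norm_sq_toL2S_eq_sum_box (c : Site (F.P K) 0) {z : Zd (F.P K).d} {R : ℤ} (hR : 2 * R + 1 ≤ ((F.P K).sitesPerDir 0 : ℤ))
    (φ : Site (F.P K) 0 → Matrix (Fin 2) (Fin 2) ℂ) (hφ : ∀ x, (∀ y ∈ box z R, transl c y ≠ x) → φ x = 0) :
    ‖toL2S F K c₀ φ‖ ^ 2 = c₀ * ∑ y ∈ box z R, ∑ j : Fin 2, ∑ k : Fin 2, ‖(φ (transl c y)) j k‖ ^ 2 := by
  rw [norm_sq_toL2S, sum_site_eq_sum_box c hR (fun x => ∑ j : Fin 2, ∑ k : Fin 2, ‖(φ x) j k‖ ^ 2) fun x hx => by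
    rw [hφ x hx]; simp]

/-- ★★ **THE GRADIENT ENERGY `‖D_W (toL2S φ)‖²` IS `c₀ℓ²` TIMES THE BOX SUM OF px4's `∇_Vφ(y,μ) = Ad(V y μ)φ(y + e_μ) − φ y`** (Frobenius letters) for a site field vanishing off
the chart image of `Q_{R−1}(z)` (`2R + 1 ≤ N`). [cite: Balaban1985BackgroundPropagators, (3.3) p.391, (3.100) p.413; Balaban1985RegularSpaces, (1.1) p.76] -/
theorem norm_sq_DL2_toL2S_eq_sum_box (c : Site (F.P K) 0) {z : Zd (F.P K).d} {R : ℤ} (hR : 2 * R + 1 ≤ ((F.P K).sitesPerDir 0 : ℤ))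
    (W : GaugeField (F.P K) 0 (Matrix.specialUnitaryGroup (Fin 2) ℂ))
    (φ : Site (F.P K) 0 → Matrix (Fin 2) (Fin 2) ℂ) (hφ : ∀ x, (∀ y ∈ box z (R - 1), transl c y ≠ x) → φ x = 0) :
    ‖DL2 F n K c₀ W (toL2S F K c₀ φ)‖ ^ 2
      = c₀ * ((F.L : ℝ) ^ (K - n)) ^ 2 * ∑ y ∈ box z R, ∑ μ : Fin (F.P K).d, ∑ j : Fin 2, ∑ k : Fin 2,
          ‖(conjR (unitsField (toUField W) ⟨transl c y, μ⟩) (φ (transl c (y + unitVec μ))) - φ (transl c y)) j k‖ ^ 2 := by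
  have hη : 0 < eta F n K := eta_pos F n K
  -- read `D_W (toL2S φ)` back as a bond field
  have hX : DL2 F n K c₀ W (toL2S F K c₀ φ) = toL2 F K c₀ ((toL2 F K c₀).symm (DL2 F n K c₀ W (toL2S F K c₀ φ))) := by
    rw [LinearEquiv.apply_symm_apply]
  rw [hX, norm_toL2_sq]
  -- the bond field vanishes off the bonds based in the chart image of `Q_R(z)`
  have hsupp : ∀ b : PBond (F.P K) 0, (∀ y ∈ box z R, transl c y ≠ b.src) → (toL2 F K c₀).symm (DL2 F n K c₀ W (toL2S F K c₀ φ)) b = 0 := by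
    intro b hb
    rw [DL2_toL2S_eq_covDerivFwdT, covDerivFwdT, hφ _ (shift_ne_transl_of_ne c hb b.dir), hφ _ (ne_transl_of_ne c hb)]
    simp [conjR]
  rw [sum_bond_eq_sum_box c hR _ fun b hb => by rw [hsupp b hb, map_zero, norm_zero, zero_pow two_ne_zero]]
  rw [mul_assoc]
  congr 1
  rw [Finset.mul_sum]
  refine Finset.sum_congr rfl fun y _ => ?_
  rw [Finset.mul_sum]
  refine Finset.sum_congr rfl fun μ _ => ?_
  rw [norm_sq_frobEquiv_symm, DL2_toL2S_eq_covDerivFwdT, covDerivFwdT, ← transl_add_unitVec, Finset.mul_sum]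
  refine Finset.sum_congr rfl fun j _ => ?_
  rw [Finset.mul_sum]
  refine Finset.sum_congr rfl fun k _ => ?_
  rw [Matrix.smul_apply, norm_smul, mul_pow, Real.norm_eq_abs, abs_of_pos (inv_pos.mpr hη), inv_eta_sq_eq]
  rfl

/-- **OPERATOR-NORM READING, BOTH WAYS** with `GRAD_box(V,φ) := Σ_{y ∈ Q_R(z)} Σ_μ ‖conjR (V y μ) (φ (y + e_μ)) − φ y‖²` ((B8)(i)'s token shape):
`c₀ℓ²·GRAD_box ≤ ‖D_W (toL2S φ)‖² ≤ 2c₀ℓ²·GRAD_box` for any `φ′`, `V` agreeing with the pull-backs. [cite: Balaban1985BackgroundPropagators, (3.3) p.391; Balaban1985Averaging, (18)-(20) p.21] -/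
theorem norm_sq_DL2_toL2S_le_ge_box (c : Site (F.P K) 0) {z : Zd (F.P K).d} {R : ℤ} (hR : 2 * R + 1 ≤ ((F.P K).sitesPerDir 0 : ℤ))
    (W : GaugeField (F.P K) 0 (Matrix.specialUnitaryGroup (Fin 2) ℂ))
    (φ : Site (F.P K) 0 → Matrix (Fin 2) (Fin 2) ℂ) (hφ : ∀ x, (∀ y ∈ box z (R - 1), transl c y ≠ x) → φ x = 0)
    (ψ : Zd (F.P K).d → Matrix (Fin 2) (Fin 2) ℂ) (hψ : ∀ y, ψ y = φ (transl c y))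
    (V : Zd (F.P K).d → Fin (F.P K).d → (Matrix (Fin 2) (Fin 2) ℂ)ˣ) (hV : ∀ y μ, V y μ = unitsField (toUField W) ⟨transl c y, μ⟩) :
    c₀ * ((F.L : ℝ) ^ (K - n)) ^ 2 * ∑ y ∈ box z R, ∑ μ, ‖conjR (V y μ) (ψ (y + unitVec μ)) - ψ y‖ ^ 2 ≤ ‖DL2 F n K c₀ W (toL2S F K c₀ φ)‖ ^ 2 ∧
      ‖DL2 F n K c₀ W (toL2S F K c₀ φ)‖ ^ 2 ≤ 2 * (c₀ * ((F.L : ℝ) ^ (K - n)) ^ 2) * ∑ y ∈ box z R, ∑ μ, ‖conjR (V y μ) (ψ (y + unitVec μ)) - ψ y‖ ^ 2 := by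
  have hc₀ : 0 < c₀ := Fact.out
  have hpos : 0 ≤ c₀ * ((F.L : ℝ) ^ (K - n)) ^ 2 := by positivity
  rw [norm_sq_DL2_toL2S_eq_sum_box F n K c₀ c hR W φ hφ]
  simp only [hψ, hV]
  constructor
  · exact mul_le_mul_of_nonneg_left (Finset.sum_le_sum fun y _ => Finset.sum_le_sum fun μ _ => MatrixNorms.opNorm_sq_le_sum_norm_sq _) hpos
  · rw [mul_assoc (2 : ℝ), mul_left_comm (2 : ℝ), Finset.mul_sum (s := box z R) (a := (2 : ℝ))]
    refine mul_le_mul_of_nonneg_left (Finset.sum_le_sum fun y _ => ?_) hpos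
    rw [Finset.mul_sum]
    exact Finset.sum_le_sum fun μ _ => sum_norm_sq_le_two_mul_opNorm_sq _

end Member

end Summit.QuantumFields.YangMills.Theorems.Prop7BoxChartTransport

end
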